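/-
Copyright (c) 2026 the pub-hodgecm-mathlib formalisation cell (harness21).  Prover seat hodgecm-mathlib-K2E2-p12 (g10), Track B «K2-LIT», h413 = `stmt-HodgeConjecture-24833`,
route `HCCMUnconditional`; R90-TF section S8 «ContSpec-n½», deal S8-R239 (3) (S8 dealer R90-CS-plan (g3)): THE ∀-GENERATOR TWIN of ★ p864823 — the Euler factorisation
`q_j = cS·a_j` of the scattering coordinates of EVERY `K`-finite generator (the exports of ★ p864481's τ-ports in place of the witness exports), modulo the per-generator
factorisation letter `hunfK` on `K_max`; census `R90/S8/CENSUS-EulerKFinite.K2E2-p12-g10.md` 2a3c0bdbb064f906.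
-/
import Summits.HodgeConjecture.HodgeConjecture.Theorems.K2E1ChiScatteringCoordsEulerFactorisationCMThree          -- ★ p864823 (this seat): the Cramer engine, the columns on `K_max`, the bound near a candidate
import Summits.HodgeConjecture.HodgeConjecture.Theorems.K2E1ChiEisensteinMeromorphicExportsKFiniteOfPortsCMThree   -- ★ p864481 (K2E1-p15): the K-finite exports with both τ-ports plugged in
import HarnessLib

/-!
# h413 ∕ R90-S8 — `K2E1ChiScatteringCoordsEulerFactorisationKFiniteCMThree`: THE EULER FACTORISATION OF THE SCATTERING COORDINATES OF EVERY `K`-FINITE GENERATOR, MODULO THE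
# PER-GENERATOR FACTORISATION ON `K_max` — generic head, continued corollaries (off `3∕2`, near `3∕2`), and the K-finite exports WITH the factorisation in one package

Cell `pub/hodgecm-mathlib`, crux H413 = `stmt-HodgeConjecture-24833`, route `HCCMUnconditional`; R90-TF section S8, deal S8-R239 (3); rulings J-S8-U, J-S8-AG, J-S8-V♭.  THEOREMS ONLY
(no `def`, no `instance`, no notation, no named-fact hypothesis, no `sorry`; default heartbeats); lane `--supports stmt-HodgeConjecture-24833 --as helper` (count-neutral).  Closes no socket.

THE MATHEMATICS ([MoeglinWaldspurger1995, II.1.7, IV.1.10–IV.1.11]; [Langlands1976, §6]; [ShahidiAJM1981, §2]; [BernsteinLapid2019, §4 p. 10, §7]).  ★ p864823 factorised the tube coordinates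
of the (V) WITNESS; the same linear algebra factorises the coordinates of ANY `K`-finite generator `φ`: the exports (★ `chiEisenstein_meromorphic_exports_kfinite_of_ports`) span the
normalised intertwined function `z ↦ (ν𝓕)⁻¹·∫_N φ_z(w₀·v·g) dν·H(g)^{z−2}` on the tube `{2 < Re}` by LINEARLY INDEPENDENT pair-section columns `φ′_j` with coordinates `q_j`; the columns stay
linearly independent ON `K_max` (★ `linearIndependent_restrict_comap_of_isChiSectionPair`), so finitely many evaluation points `g_k ∈ K_max` with invertible matrix `φ′_j(g_k)` exist
(★ `exists_points_det_ne_zero`), where `H(g_k) = 1`; hence the PER-BASE-POINT Euler factorisation «`∫_N φ_z(w₀·v·k) dν = cS(z)·A_k(z)`, `A_k` holomorphic on `{1 < Re}`» at the points of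
`K_max` (the letter `hunfK`, one per generator; [MW95 II.1.7], [Langlands1976 §6], [ShahidiAJM1981 §2]: unramified local intertwiners are the scalar `cS`'s Euler factors, the rest is a
finite product of holomorphic local amplitudes) gives `q_j = cS·a_j` on the tube with `a_j := (ν𝓕)⁻¹·Σ_k (Mᵀ)⁻¹_{jk}·A_k` HOLOMORPHIC ON `{1 < Re}` (★ Cramer engine
`exists_factorisation_of_coords_at_points`, verbatim).  CONTINUED COROLLARIES, generic in the continued coordinate `qc` (analytic off a closed co-discrete `P ⊆ {Re ≤ 2}`, `= q` on the
tube) and in the scalar's holomorphic multiple `(z−2)(2z−3)·cS = G` on the tube (`G` holomorphic on `{1<Re}`; ★ F4 for the `(S,T)`-ratio, or any other frame): `(z−2)(2z−3)·qc = G·a` on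
the CONNECTED `{1<Re} ∖ P` (identity theorem; ★ `isPreconnected_convex_diff_of_countable`), so `qc` is ANALYTIC at every point of `{1<Re} ∖ {3∕2}` where it is in normal form (and `G 2 = 0`
if the point is `2`) — Riemann ★ —, and `qc = (G∕((z−2)(2z−3)))·a` on a punctured neighbourhood of `3∕2` (the `r_j := a_j` of (R)′'s `hSCAT` rows, analytic AT `3∕2`).
* §1 **`exists_eulerFactorisation_of_tubeClause`** — GENERIC HEAD per generator (any finite index type, any `(χ₁, χ₂)`-pair-section columns, the export's tube clause BYTES, the letter
  `hunfK`) ⊢ `∃ a, (∀ j, DifferentiableOn ℂ (a j) {1<Re}) ∧ ∀ j z, 2 < Re z → q j z = cS z * a j z` (K2E1-p13's `hfacτ` per τ-admissible generator; (R)′'s `hSCATrows` input).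
* §2 **`mul_coord_eqOn_of_eulerFactorisation`**, **`analyticAt_coord_of_eulerFactorisation`**, **`eventuallyEq_coord_near_threeHalves_of_eulerFactorisation`** — the continued corollaries.
* §3 **`exists_eulerFactorisation_kfinite_of_ports`** (+ **`_of_coweightLine`**) — ★ p864481's K-finite exports (both τ-ports plugged in) WITH the Euler factorisation: the ★ statement
  with `a` added to the ∃-tuple and the two Euler clauses appended, for every `φ ∈ V`, modulo `hunfK` for `φ` (pure-type letters `hVB hVτ hline` ∕ the co-weight line untouched).
HONEST LABEL: HC_CM is proved only modulo the 7 printed citations (2 remaining named inputs: hLiu418 = `stmt-HodgeConjecture-24832`, h413 = `stmt-HodgeConjecture-24833`) until rung 0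
closes; this file asserts no named fact and closes no socket; per generator EXACTLY ONE visible letter `hunfK` (arch-agnostic: the `K_∞`-type amplitude is its PAYER's binder —
K2E1-p14's `hunfK_of_core` at one-dimensional τ; honest L at exotic τ); count-neutral.

## References
* [MoeglinWaldspurger1995] C. Mœglin, J.-L. Waldspurger, *Spectral Decomposition and Eisenstein Series* (1995), II.1.7, IV.1.10–IV.1.11.
* [Langlands1976] R. P. Langlands, *On the Functional Equations Satisfied by Eisenstein Series*, LNM 544 (1976), §6.
* [ShahidiAJM1981] F. Shahidi, *On certain L-functions*, Amer. J. Math. 103 (1981), §2.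
* [BernsteinLapid2019] J. Bernstein, E. Lapid, *On the meromorphic continuation of Eisenstein series*, J. AMS 37 (2024), §4 p. 10, §7.
-/

set_option autoImplicit false
set_option linter.dupNamespace false  -- the mandated namespace repeats the summit's segment (`HodgeConjecture.HodgeConjecture`)

noncomputable section

open MeasureTheory Measure NumberField IsDedekindDomain Set Filter Topology Matrix
open scoped ENNReal NNReal ComplexConjugate
open Literature.MeasureTheory.Group Literature.NumberTheory Literature.NumberTheory.Automorphic Literature.NumberTheory.Automorphic.UnitaryGroup Literature.NumberTheory.GaloisRepresentations AdelicGroupData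
open Literature.NumberTheory.Automorphic.Arthur2013.Leaves.TECR Literature.NumberTheory.Rogawski1990 Literature.NumberTheory.LFunctions
open Summit.HodgeConjecture.HodgeConjecture.Cruxes.H413.K2E1BorelEisensteinU Summit.HodgeConjecture.HodgeConjecture.Cruxes.H413.K2E1CharacterEisensteinU2Defs
open Summit.HodgeConjecture.HodgeConjecture.Cruxes.H413.K2E1CharacterEisensteinU3PairDefs Summit.HodgeConjecture.HodgeConjecture.Cruxes.H413.K2E1BLBorelSpacesU2Defs
open Summit.HodgeConjecture.HodgeConjecture.Cruxes.H413.K2E1BLBorelOperatorsU2Defs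
open Summit.HodgeConjecture.HodgeConjecture.Cruxes.H413.K2E1LinearIndependentEvalMatrix (exists_points_det_ne_zero)
open Summit.HodgeConjecture.HodgeConjecture.Cruxes.H413.K2E1ConvexDiffCountableConnected (isPreconnected_convex_diff_of_countable countable_of_codiscrete)
open Summit.HodgeConjecture.HodgeConjecture.Cruxes.H413.K2E1SphericalHeckeEigenSectionU2 (borelHeight_eq_one_of_mem)
open Summit.HodgeConjecture.HodgeConjecture.Cruxes.H413.K2E1ChiScatteringCoordsEulerFactorisationCMThree (exists_factorisation_of_coords_at_points linearIndependent_restrict_comap_of_isChiSectionPair eventually_norm_le_of_eqOn_mul)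
open Summit.HodgeConjecture.HodgeConjecture.Cruxes.H413.K2E1ChiEisensteinMeromorphicExportsKFiniteOfPortsCMThree (chiEisenstein_meromorphic_exports_kfinite_of_ports chiEisenstein_meromorphic_exports_kfinite_of_ports_of_coweightLine)

namespace Summit.HodgeConjecture.HodgeConjecture.Cruxes.H413.K2E1ChiScatteringCoordsEulerFactorisationKFiniteCMThree

/-! ## §1 GENERIC HEAD: the Euler factorisation of the coordinates of one generator from `hunfK` -/

section Generic
variable (L : Type) [Field L] [NumberField L] [IsCMField L] [MeasurableSpace (quasiSplit (↥(maximalRealSubfield L)) L (IsCMField.complexConj L) 3).Adelic]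

/-- **THE EULER FACTORISATION OF THE SCATTERING COORDINATES OF ONE GENERATOR** (K2E1-p13's `hfacτ`, (R)′'s `hSCAT` input): columns `φ′_j` = linearly independent `(χ₁, χ₂)`-pair-sections,
coordinates `q_j` with the K-finite export's tube clause «`Σ_j q_j(z)•φ′_j = (ν𝓕)⁻¹•(g ↦ ∫_N φ_z(w₀·v·g) dν·H(g)^{z−2})` on `{2 < Re}`» (★ p864481's bytes), and the per-base-point
factorisation `hunfK` of `φ` on `K_max` for the scalar `cS` ⊢ `q_j = cS·a_j` on the tube with every `a_j` HOLOMORPHIC ON `{1 < Re}` (`H = 1` on `K_max` ★; evaluation points ★; Cramer ★).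
[cite: MoeglinWaldspurger1995, II.1.7, IV.1.11] [cite: Langlands1976, §6] [cite: ShahidiAJM1981, §2] [cite: BernsteinLapid2019, §7] -/
theorem exists_eulerFactorisation_of_tubeClause {ι : Type*} [Fintype ι] {χ₁ : HeckeCharacter L} {χ₂ : ↥(TorusDict.torus (IsCMField.complexConj L)) →ₜ* ℂˣ}
    {φ' : ι → (quasiSplit (↥(maximalRealSubfield L)) L (IsCMField.complexConj L) 3).Adelic → ℂ} (hli : LinearIndependent ℂ φ') (hb : ∀ j, IsChiSectionPair χ₁ χ₂ (φ' j))
    {φ : (quasiSplit (↥(maximalRealSubfield L)) L (IsCMField.complexConj L) 3).Adelic → ℂ} (ν : Measure ↥(adelicUnipotent (↥(maximalRealSubfield L)) L (IsCMField.complexConj L) 3)) (𝓕 : Set ↥(adelicUnipotent (↥(maximalRealSubfield L)) L (IsCMField.complexConj L) 3)) {q : ι → ℂ → ℂ}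
    (hqφ : ∀ z : ℂ, 2 < z.re → (∑ j, q j z • φ' j) = ((((ν 𝓕).toReal⁻¹ : ℝ)) : ℂ) • (fun g : (quasiSplit (↥(maximalRealSubfield L)) L (IsCMField.complexConj L) 3).Adelic => (∫ v : ↥(adelicUnipotent (↥(maximalRealSubfield L)) L (IsCMField.complexConj L) 3), flatSectionU φ z ((quasiSplit (↥(maximalRealSubfield L)) L (IsCMField.complexConj L) 3).toAdelic (weylLongU ((IsCMField.complexConj L : L ≃ₐ[↥(maximalRealSubfield L)] L) : L →+* L) (rfl : (StdForm.antidiagonal 3).over L = (StdForm.antidiagonal 3).over L)) * ((v : (quasiSplit (↥(maximalRealSubfield L)) L (IsCMField.complexConj L) 3).Adelic) * g)) ∂ν) * (((borelHeight g : ℝ) : ℂ) ^ (z - 2))))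
    {cS : ℂ → ℂ}
    (hunfK : ∀ k : (quasiSplit (↥(maximalRealSubfield L)) L (IsCMField.complexConj L) 3).Adelic, adelicVal (↥(maximalRealSubfield L)) L (IsCMField.complexConj L) 3 ((StdForm.antidiagonal 3).over L) k ∈ standardMaximalCompactGL 3 L →
      ∃ A : ℂ → ℂ, DifferentiableOn ℂ A {z : ℂ | 1 < z.re} ∧ ∀ z : ℂ, 2 < z.re →
        (∫ v : ↥(adelicUnipotent (↥(maximalRealSubfield L)) L (IsCMField.complexConj L) 3), flatSectionU φ z ((quasiSplit (↥(maximalRealSubfield L)) L (IsCMField.complexConj L) 3).toAdelic (weylLongU ((IsCMField.complexConj L : L ≃ₐ[↥(maximalRealSubfield L)] L) : L →+* L) (rfl : (StdForm.antidiagonal 3).over L = (StdForm.antidiagonal 3).over L)) * ((v : (quasiSplit (↥(maximalRealSubfield L)) L (IsCMField.complexConj L) 3).Adelic) * k)) ∂ν) = cS z * A z) :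
    ∃ a : ι → ℂ → ℂ, (∀ j, DifferentiableOn ℂ (a j) {z : ℂ | 1 < z.re}) ∧ ∀ j (z : ℂ), 2 < z.re → q j z = cS z * a j z := by
  classical
  -- evaluation points in `K_max` with invertible matrix (the columns stay linearly independent there)
  obtain ⟨gK, hdet⟩ := exists_points_det_ne_zero (linearIndependent_restrict_comap_of_isChiSectionPair L hli hb)
  -- the letter at the evaluation points
  choose A hA hfac using fun k : ι => hunfK (gK k : (quasiSplit (↥(maximalRealSubfield L)) L (IsCMField.complexConj L) 3).Adelic) (Subgroup.mem_comap.1 (gK k).2)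
  -- the tube clause read at the points of `K_max` (`H(k) = 1`)
  have hq : ∀ z ∈ {z : ℂ | 2 < z.re}, (∑ j, q j z • fun k : ↥((standardMaximalCompactGL 3 L).comap (adelicVal (↥(maximalRealSubfield L)) L (IsCMField.complexConj L) 3 ((StdForm.antidiagonal 3).over L)) : Subgroup (quasiSplit (↥(maximalRealSubfield L)) L (IsCMField.complexConj L) 3).Adelic) => φ' j (k : (quasiSplit (↥(maximalRealSubfield L)) L (IsCMField.complexConj L) 3).Adelic)) =
      fun k : ↥((standardMaximalCompactGL 3 L).comap (adelicVal (↥(maximalRealSubfield L)) L (IsCMField.complexConj L) 3 ((StdForm.antidiagonal 3).over L)) : Subgroup (quasiSplit (↥(maximalRealSubfield L)) L (IsCMField.complexConj L) 3).Adelic) => ((((ν 𝓕).toReal⁻¹ : ℝ)) : ℂ) * (∫ v : ↥(adelicUnipotent (↥(maximalRealSubfield L)) L (IsCMField.complexConj L) 3), flatSectionU φ z ((quasiSplit (↥(maximalRealSubfield L)) L (IsCMField.complexConj L) 3).toAdelic (weylLongU ((IsCMField.complexConj L : L ≃ₐ[↥(maximalRealSubfield L)] L) : L →+* L) (rfl :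 (StdForm.antidiagonal 3).over L = (StdForm.antidiagonal 3).over L)) * ((v : (quasiSplit (↥(maximalRealSubfield L)) L (IsCMField.complexConj L) 3).Adelic) * (k : (quasiSplit (↥(maximalRealSubfield L)) L (IsCMField.complexConj L) 3).Adelic))) ∂ν) := by
    intro z hz
    funext k
    have h := congrFun (hqφ z hz) (k : (quasiSplit (↥(maximalRealSubfield L)) L (IsCMField.complexConj L) 3).Adelic)
    rw [Finset.sum_apply] at h ⊢
    simp only [Pi.smul_apply, smul_eq_mul] at h ⊢
    rw [h, borelHeight_eq_one_of_mem (Subgroup.mem_comap.1 k.2), NNReal.coe_one, Complex.ofReal_one, Complex.one_cpow, mul_one]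
  obtain ⟨a, ha, hqa', -⟩ := exists_factorisation_of_coords_at_points (X := ↥((standardMaximalCompactGL 3 L).comap (adelicVal (↥(maximalRealSubfield L)) L (IsCMField.complexConj L) 3 ((StdForm.antidiagonal 3).over L)) : Subgroup (quasiSplit (↥(maximalRealSubfield L)) L (IsCMField.complexConj L) 3).Adelic))
    (φ' := fun j (k : ↥((standardMaximalCompactGL 3 L).comap (adelicVal (↥(maximalRealSubfield L)) L (IsCMField.complexConj L) 3 ((StdForm.antidiagonal 3).over L)) : Subgroup (quasiSplit (↥(maximalRealSubfield L)) L (IsCMField.complexConj L) 3).Adelic)) => φ' j (k : (quasiSplit (↥(maximalRealSubfield L)) L (IsCMField.complexConj L) 3).Adelic)) (g := gK)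
    (Φ := fun (z : ℂ) (k : ↥((standardMaximalCompactGL 3 L).comap (adelicVal (↥(maximalRealSubfield L)) L (IsCMField.complexConj L) 3 ((StdForm.antidiagonal 3).over L)) : Subgroup (quasiSplit (↥(maximalRealSubfield L)) L (IsCMField.complexConj L) 3).Adelic)) => ((((ν 𝓕).toReal⁻¹ : ℝ)) : ℂ) * (∫ v : ↥(adelicUnipotent (↥(maximalRealSubfield L)) L (IsCMField.complexConj L) 3), flatSectionU φ z ((quasiSplit (↥(maximalRealSubfield L)) L (IsCMField.complexConj L) 3).toAdelic (weylLongU ((IsCMField.complexConj L : L ≃ₐ[↥(maximalRealSubfield L)] L) : L →+* L) (rfl : (StdForm.antidiagonal 3).over L = (StdForm.antidiagonal 3).over L)) * ((v : (quasiSplit (↥(maximalRealSubfield L)) L (IsCMField.complexConj L) 3).Adelic) * (k : (quasiSplit (↥(maximalRealSubfield L)) L (IsCMField.complexConj L) 3).Adelic))) ∂ν))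
    (cS := cS) (A := fun k z => ((((ν 𝓕).toReal⁻¹ : ℝ)) : ℂ) * A k z) hdet hq (fun z hz k => by simp only [hfac k z hz]; ring) fun k => (hA k).const_mul _
  exact ⟨a, ha, fun j z hz => hqa' j z hz⟩

end Generic

/-! ## §2 The continued corollaries: the factored identity on `{1<Re} ∖ P`, analyticity off `3∕2`, the germ at `3∕2` -/

section Continued

/-- **THE FACTORED IDENTITY ON `{1 < Re} ∖ P`**: a continued coordinate `qc` (analytic off the closed co-discrete `P ⊆ {Re ≤ 2}`, `= q` on the tube), the factorisation `q = cS·a` on the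
tube (`a` holomorphic on `{1<Re}`) and a holomorphic multiple `(z−2)(2z−3)·cS = G` on the tube (`G` holomorphic on `{1<Re}`) give `(z−2)(2z−3)·qc = G·a` on the CONNECTED `{1<Re} ∖ P`
(identity theorem from the base point `3`). [cite: MoeglinWaldspurger1995, IV.1.11] -/
theorem mul_coord_eqOn_of_eulerFactorisation {qc q a cS G : ℂ → ℂ} {P : Set ℂ}
    (hPcd : ∀ z₀ : ℂ, ∀ᶠ s in 𝓝[≠] z₀, s ∉ P) (hPre : ∀ z ∈ P, z.re ≤ 2) (hqcP : ∀ z : ℂ, z ∉ P → AnalyticAt ℂ qc z)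
    (hqcq : ∀ z : ℂ, 2 < z.re → qc z = q z) (hqa : ∀ z : ℂ, 2 < z.re → q z = cS z * a z) (ha : DifferentiableOn ℂ a {z : ℂ | 1 < z.re})
    (hG : DifferentiableOn ℂ G {z : ℂ | 1 < z.re}) (hcS : ∀ z : ℂ, 2 < z.re → (z - 2) * (2 * z - 3) * cS z = G z) :
    EqOn (fun z => (z - 2) * (2 * z - 3) * qc z) (fun z => G z * a z) ({z : ℂ | 1 < z.re} \ P) := by
  have hO : IsOpen {z : ℂ | 1 < z.re} := isOpen_lt continuous_const Complex.continuous_re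
  have hDpc : IsPreconnected ({z : ℂ | 1 < z.re} \ P) :=
    isPreconnected_convex_diff_of_countable Literature.Topology.Euclidean.one_lt_rank_real_complex (convex_halfSpace_re_gt (1 : ℝ)) hO (countable_of_codiscrete hPcd)
  have hu : AnalyticOnNhd ℂ (fun z => (z - 2) * (2 * z - 3) * qc z) ({z : ℂ | 1 < z.re} \ P) :=
    fun z hz => ((analyticAt_id.sub analyticAt_const).mul ((analyticAt_const.mul analyticAt_id).sub analyticAt_const)).mul (hqcP z hz.2)
  have hv : AnalyticOnNhd ℂ (fun z => G z * a z) ({z : ℂ | 1 < z.re} \ P) :=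
    fun z hz => (hG.analyticAt (hO.mem_nhds hz.1)).mul (ha.analyticAt (hO.mem_nhds hz.1))
  have h3 : (3 : ℂ) ∈ {z : ℂ | 1 < z.re} \ P := by
    refine ⟨by norm_num, fun h => ?_⟩
    have h' := hPre _ h
    norm_num at h'
  have heq : (fun z => (z - 2) * (2 * z - 3) * qc z) =ᶠ[𝓝 (3 : ℂ)] fun z => G z * a z := by
    filter_upwards [(isOpen_lt continuous_const Complex.continuous_re).mem_nhds (show (3 : ℂ) ∈ {z : ℂ | 2 < z.re} by norm_num)] with z hz
    rw [hqcq z hz, hqa z hz, ← hcS z hz]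
    ring
  exact hu.eqOn_of_preconnected_of_eventuallyEq hv hDpc h3 heq

/-- **ANALYTICITY OF THE CONTINUED COORDINATE OFF `3∕2`**: under `mul_coord_eqOn_of_eulerFactorisation`'s hypotheses, at every `z₀` with `1 < Re z₀`, `z₀ ≠ 3∕2` where `qc` is in normal
form (and `G 2 = 0` if `z₀ = 2`), `qc` is ANALYTIC — bounded near `z₀` by ★ `eventually_norm_le_of_eqOn_mul`, then Riemann in normal form ★. (For `z₀ ∉ P` this is `hqcP`; the content
is at the candidates `z₀ ∈ P`.) [cite: MoeglinWaldspurger1995, IV.1.10–IV.1.11] -/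
theorem analyticAt_coord_of_eulerFactorisation {qc q a cS G : ℂ → ℂ} {P : Set ℂ}
    (hPcd : ∀ z₀ : ℂ, ∀ᶠ s in 𝓝[≠] z₀, s ∉ P) (hPre : ∀ z ∈ P, z.re ≤ 2) (hqcP : ∀ z : ℂ, z ∉ P → AnalyticAt ℂ qc z)
    (hqcq : ∀ z : ℂ, 2 < z.re → qc z = q z) (hqa : ∀ z : ℂ, 2 < z.re → q z = cS z * a z) (ha : DifferentiableOn ℂ a {z : ℂ | 1 < z.re})
    (hG : DifferentiableOn ℂ G {z : ℂ | 1 < z.re}) (hcS : ∀ z : ℂ, 2 < z.re → (z - 2) * (2 * z - 3) * cS z = G z)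
    {z₀ : ℂ} (hNF : MeromorphicNFAt qc z₀) (hz₀ : 1 < z₀.re) (h32 : z₀ ≠ 3 / 2) (h2 : z₀ = 2 → G 2 = 0) :
    AnalyticAt ℂ qc z₀ := by
  have hO : IsOpen {z : ℂ | 1 < z.re} := isOpen_lt continuous_const Complex.continuous_re
  have hEqOn := mul_coord_eqOn_of_eulerFactorisation hPcd hPre hqcP hqcq hqa ha hG hcS
  have hDev : ∀ᶠ z in 𝓝[≠] z₀, z ∈ {z : ℂ | 1 < z.re} \ P := by
    filter_upwards [mem_nhdsWithin_of_mem_nhds (hO.mem_nhds hz₀), hPcd z₀] with z hz hzP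
    exact ⟨hz, hzP⟩
  exact hNF.analyticAt_of_eventually_norm_le
    (eventually_norm_le_of_eqOn_mul hDev hEqOn ((hG.differentiableAt (hO.mem_nhds hz₀)).mul (ha.differentiableAt (hO.mem_nhds hz₀))) h32
      fun h => by rw [h2 h, zero_mul])

/-- **THE GERM AT `3∕2`**: under the same hypotheses, `qc = (G ∕ ((z−2)(2z−3)))·a` on a punctured neighbourhood of `3∕2` — the `r_j := a_j` (analytic AT `3∕2`, `a` being holomorphic
on `{1<Re} ∋ 3∕2`) of (R)′'s `hSCAT` rows «`qcv_j = q̃c·r_j` near `3∕2`», with `q̃c := G∕((z−2)(2z−3))` the continued scalar. [cite: MoeglinWaldspurger1995, IV.1.11] -/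
theorem eventuallyEq_coord_near_threeHalves_of_eulerFactorisation {qc q a cS G : ℂ → ℂ} {P : Set ℂ}
    (hPcd : ∀ z₀ : ℂ, ∀ᶠ s in 𝓝[≠] z₀, s ∉ P) (hPre : ∀ z ∈ P, z.re ≤ 2) (hqcP : ∀ z : ℂ, z ∉ P → AnalyticAt ℂ qc z)
    (hqcq : ∀ z : ℂ, 2 < z.re → qc z = q z) (hqa : ∀ z : ℂ, 2 < z.re → q z = cS z * a z) (ha : DifferentiableOn ℂ a {z : ℂ | 1 < z.re})
    (hG : DifferentiableOn ℂ G {z : ℂ | 1 < z.re}) (hcS : ∀ z : ℂ, 2 < z.re → (z - 2) * (2 * z - 3) * cS z = G z) :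
    ∀ᶠ z in 𝓝[≠] ((3 : ℂ) / 2), qc z = G z / ((z - 2) * (2 * z - 3)) * a z := by
  have hO : IsOpen {z : ℂ | 1 < z.re} := isOpen_lt continuous_const Complex.continuous_re
  have hEqOn := mul_coord_eqOn_of_eulerFactorisation hPcd hPre hqcP hqcq hqa ha hG hcS
  have h32 : (3 : ℂ) / 2 ∈ {z : ℂ | 1 < z.re} := by
    rw [mem_setOf_eq, Complex.div_ofNat_re]
    norm_num
  have h2 : ∀ᶠ z in 𝓝 ((3 : ℂ) / 2), z ≠ 2 := eventually_ne_nhds (by norm_num)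
  filter_upwards [mem_nhdsWithin_of_mem_nhds (hO.mem_nhds h32), hPcd _, mem_nhdsWithin_of_mem_nhds h2, self_mem_nhdsWithin] with z hz hzP hz2 hz32
  have hne : (z - 2) * (2 * z - 3) ≠ 0 := by
    refine mul_ne_zero (sub_ne_zero.2 hz2) fun h => hz32 ?_
    have : z = 3 / 2 := by linear_combination h / 2
    exact this
  have h : (z - 2) * (2 * z - 3) * qc z = G z * a z := hEqOn ⟨hz, hzP⟩
  rw [div_mul_eq_mul_div, eq_div_iff hne]
  linear_combination h

end Continued

/-! ## §3 AT THE K-FINITE EXPORTS (both τ-ports plugged in): the exports WITH the Euler factorisation, per generator -/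

section OfPorts

variable (L : Type) [Field L] [NumberField L] [IsCMField L]
  [MeasurableSpace (quasiSplit (↥(maximalRealSubfield L)) L (IsCMField.complexConj L) 3).Adelic] [BorelSpace (quasiSplit (↥(maximalRealSubfield L)) L (IsCMField.complexConj L) 3).Adelic]
  [MeasurableSpace (arch (↥(maximalRealSubfield L)) L (IsCMField.complexConj L) 3 ((StdForm.antidiagonal 3).over L))] [BorelSpace (arch (↥(maximalRealSubfield L)) L (IsCMField.complexConj L) 3 ((StdForm.antidiagonal 3).over L))]
  [MeasurableSpace (finAdelic (↥(maximalRealSubfield L)) L (IsCMField.complexConj L) 3 ((StdForm.antidiagonal 3).over L))] [BorelSpace (finAdelic (↥(maximalRealSubfield L)) L (IsCMField.complexConj L) 3 ((StdForm.antidiagonal 3).over L))]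
  (μ : Measure (quasiSplit (↥(maximalRealSubfield L)) L (IsCMField.complexConj L) 3).automorphicQuotient) [(quasiSplit (↥(maximalRealSubfield L)) L (IsCMField.complexConj L) 3).IsAutomorphicMeasure μ]
  (νG : Measure (quasiSplit (↥(maximalRealSubfield L)) L (IsCMField.complexConj L) 3).Adelic) [νG.IsHaarMeasure] [νG.IsInvInvariant] [SFinite νG]
  (ν : Measure ↥(adelicUnipotent (↥(maximalRealSubfield L)) L (IsCMField.complexConj L) 3)) [ν.IsHaarMeasure] [ν.IsMulRightInvariant] [ν.IsInvInvariant]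
  {𝓕 : Set ↥(adelicUnipotent (↥(maximalRealSubfield L)) L (IsCMField.complexConj L) 3)}
  (h𝓕N : IsFundamentalDomain ↥(rationalUnipotent (↥(maximalRealSubfield L)) L (IsCMField.complexConj L) 3) 𝓕 ν) (h𝓕c : IsCompact (closure 𝓕)) (h𝓕₀ : ν 𝓕 ≠ 0)
  {β : (quasiSplit (↥(maximalRealSubfield L)) L (IsCMField.complexConj L) 3).Adelic → ℝ≥0∞}
  (hβ : IsCoveringWeight ↥((arithmeticBorel (↥(maximalRealSubfield L)) L (IsCMField.complexConj L) 3).map (quasiSplit (↥(maximalRealSubfield L)) L (IsCMField.complexConj L) 3).arithmeticSubgroup.subtype) β)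
  {μZ : Measure (borelQuotient (↥(maximalRealSubfield L)) L (IsCMField.complexConj L) 3)} [SFinite μZ]
  (hμZ : ∀ f : borelQuotient (↥(maximalRealSubfield L)) L (IsCMField.complexConj L) 3 → ℝ≥0∞, Measurable f → ∫⁻ z, f z ∂μZ = ∫⁻ g, β g * f (toBorelQuotient (↥(maximalRealSubfield L)) L (IsCMField.complexConj L) 3 g) ∂νG)
  -- auxiliary Haar measures on `G_∞` (two-sided) and `G(𝔸_f)` (they only enter the proofs of the ports)
  (μa : Measure (arch (↥(maximalRealSubfield L)) L (IsCMField.complexConj L) 3 ((StdForm.antidiagonal 3).over L))) [μa.IsHaarMeasure] [μa.IsMulRightInvariant]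
  (μf : Measure (finAdelic (↥(maximalRealSubfield L)) L (IsCMField.complexConj L) 3 ((StdForm.antidiagonal 3).over L))) [μf.IsHaarMeasure]
  -- the PURE-TYPE K-FINITE BLOCK: finite-dimensional, `K_max`-stable, continuous bounded `(χ₁, χ₂)`-pair-sections, `χ₂` automorphic (★ T head's block binders)
  {χ₁ : HeckeCharacter L} {χ₂ : ↥(TorusDict.torus (IsCMField.complexConj L)) →ₜ* ℂˣ} (hχ₂ : TorusDict.IsAutomorphic (IsCMField.complexConj L) χ₂)
  (V : Submodule ℂ ((quasiSplit (↥(maximalRealSubfield L)) L (IsCMField.complexConj L) 3).Adelic → ℂ)) [FiniteDimensional ℂ ↥V]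
  (hVK : ∀ k ∈ ((standardMaximalCompactGL 3 L).comap (adelicVal (↥(maximalRealSubfield L)) L (IsCMField.complexConj L) 3 ((StdForm.antidiagonal 3).over L)) : Subgroup (quasiSplit (↥(maximalRealSubfield L)) L (IsCMField.complexConj L) 3).Adelic), ∀ ψ ∈ V, (fun x => ψ (x * k)) ∈ V)
  (hVχ : ∀ ψ ∈ V, IsChiSectionPair χ₁ χ₂ ψ) (hVc : ∀ ψ ∈ V, Continuous ψ) (hVM : ∀ ψ ∈ V, ∃ M : ℝ, ∀ x, ‖ψ x‖ ≤ M)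
  -- the LEVEL `U₀ ≤ GL₃(𝒪̂)` (open compact) under which `V` is right-invariant (★ gauge port's binders)
  (U₀ : Subgroup (GL (Fin 3) (FiniteAdeleRing (𝓞 L) L))) (hU₀o : IsOpen (U₀ : Set (GL (Fin 3) (FiniteAdeleRing (𝓞 L) L)))) (hU₀c : IsCompact (U₀ : Set (GL (Fin 3) (FiniteAdeleRing (𝓞 L) L))))
  (hU₀K : U₀ ≤ glFiniteIntegralLevel 3 L)
  (hVU : ∀ φ ∈ V, ∀ b : finAdelic (↥(maximalRealSubfield L)) L (IsCMField.complexConj L) 3 ((StdForm.antidiagonal 3).over L), (b : GL (Fin 3) (FiniteAdeleRing (𝓞 L) L)) ∈ U₀ →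
    ∀ y : (quasiSplit (↥(maximalRealSubfield L)) L (IsCMField.complexConj L) 3).Adelic, φ (y * finAdelicToAdelic (↥(maximalRealSubfield L)) L (IsCMField.complexConj L) 3 ((StdForm.antidiagonal 3).over L) b) = φ y)
  -- the PURE-TYPE LETTERS (★ scalar port's binders): a `K_∞`-type `(W, τ)`, the archimedean left law `cB z` of the flat sections of `V` along `B_∞`, the `W`-isotypy of `V`
  {W : Type*} [AddCommGroup W] [Module ℂ W] (τ : arch (↥(maximalRealSubfield L)) L (IsCMField.complexConj L) 3 ((StdForm.antidiagonal 3).over L) → W →ₗ[ℂ] W)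
  (cB : ℂ → arch (↥(maximalRealSubfield L)) L (IsCMField.complexConj L) 3 ((StdForm.antidiagonal 3).over L) → ℂ)
  (hVB : ∀ (z : ℂ), ∀ φ ∈ V, ∀ b ∈ (borelAdelic (↥(maximalRealSubfield L)) L (IsCMField.complexConj L) 3).comap (archToAdelic (↥(maximalRealSubfield L)) L (IsCMField.complexConj L) 3 ((StdForm.antidiagonal 3).over L)),
    ∀ (a : arch (↥(maximalRealSubfield L)) L (IsCMField.complexConj L) 3 ((StdForm.antidiagonal 3).over L)) (xf : finAdelic (↥(maximalRealSubfield L)) L (IsCMField.complexConj L) 3 ((StdForm.antidiagonal 3).over L)),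
      flatSectionU φ z (archToAdelic (↥(maximalRealSubfield L)) L (IsCMField.complexConj L) 3 _ (b * a) * finAdelicToAdelic (↥(maximalRealSubfield L)) L (IsCMField.complexConj L) 3 _ xf) =
        cB z b * flatSectionU φ z (archToAdelic (↥(maximalRealSubfield L)) L (IsCMField.complexConj L) 3 _ a * finAdelicToAdelic (↥(maximalRealSubfield L)) L (IsCMField.complexConj L) 3 _ xf))
  (hVτ : V ≤ ⨆ (J : W →ₗ[ℂ] ((quasiSplit (↥(maximalRealSubfield L)) L (IsCMField.complexConj L) 3).Adelic → ℂ)) (_ : LinearMap.range J ≤ V ∧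
    ∀ k ∈ (((standardMaximalCompactGL 3 L).comap (adelicVal (↥(maximalRealSubfield L)) L (IsCMField.complexConj L) 3 ((StdForm.antidiagonal 3).over L))).comap
        (archToAdelic (↥(maximalRealSubfield L)) L (IsCMField.complexConj L) 3 ((StdForm.antidiagonal 3).over L))),
      ∀ (v : W) (x : (quasiSplit (↥(maximalRealSubfield L)) L (IsCMField.complexConj L) 3).Adelic), J v (x * archToAdelic (↥(maximalRealSubfield L)) L (IsCMField.complexConj L) 3 _ k) = J (τ k v) x), LinearMap.range J)

include μ h𝓕N h𝓕c h𝓕₀ hβ hμZ μa μf hχ₂ hVK hVχ hVc hVM hU₀o hU₀c hU₀K hVU hVB hVτ in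
/-- **THE K-FINITE EXPORTS WITH THE EULER FACTORISATION, PER GENERATOR** — ★ `chiEisenstein_meromorphic_exports_kfinite_of_ports` (K2E1-p15; the T head with both τ-ports plugged in,
visible pure-type letters `hVB hVτ hline`) re-packaged with the Euler factorisation of §1: for every `φ ∈ V`, modulo the per-generator factorisation letter `hunfK` on `K_max` for the
scalar `cS`, the ★ export tuple `(n, φ′, q, Ec, qc, P)` TOGETHER WITH `a : Fin n → ℂ → ℂ`, `a_j` holomorphic on `{1<Re}`, `q_j = cS·a_j` on `{2<Re}` (two clauses appended; the rest is ★'s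
statement byte for byte). [cite: BernsteinLapid2019, Thm 2.3, §4 Claim 1, §7] [cite: MoeglinWaldspurger1995, II.1.7, IV.1.8–IV.1.11] [cite: Langlands1976, §6] -/
theorem exists_eulerFactorisation_kfinite_of_ports
    (hline : ∀ z : ℂ, ∃ j₀ : W →ₗ[ℂ] (arch (↥(maximalRealSubfield L)) L (IsCMField.complexConj L) 3 ((StdForm.antidiagonal 3).over L) → ℂ),
      ∀ j : W →ₗ[ℂ] (arch (↥(maximalRealSubfield L)) L (IsCMField.complexConj L) 3 ((StdForm.antidiagonal 3).over L) → ℂ),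
        (∀ w, ∀ b ∈ (borelAdelic (↥(maximalRealSubfield L)) L (IsCMField.complexConj L) 3).comap (archToAdelic (↥(maximalRealSubfield L)) L (IsCMField.complexConj L) 3 ((StdForm.antidiagonal 3).over L)),
          ∀ g, j w (b * g) = cB z b * j w g) →
        (∀ k ∈ (((standardMaximalCompactGL 3 L).comap (adelicVal (↥(maximalRealSubfield L)) L (IsCMField.complexConj L) 3 ((StdForm.antidiagonal 3).over L))).comap
            (archToAdelic (↥(maximalRealSubfield L)) L (IsCMField.complexConj L) 3 ((StdForm.antidiagonal 3).over L))),
          ∀ (w : W) (g : arch (↥(maximalRealSubfield L)) L (IsCMField.complexConj L) 3 ((StdForm.antidiagonal 3).over L)), j w (g * k) = j (τ k w) g) → ∃ a : ℂ, j = a • j₀)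
    {φ : (quasiSplit (↥(maximalRealSubfield L)) L (IsCMField.complexConj L) 3).Adelic → ℂ} (hφ : φ ∈ V) {cS : ℂ → ℂ}
    (hunfK : ∀ k : (quasiSplit (↥(maximalRealSubfield L)) L (IsCMField.complexConj L) 3).Adelic, adelicVal (↥(maximalRealSubfield L)) L (IsCMField.complexConj L) 3 ((StdForm.antidiagonal 3).over L) k ∈ standardMaximalCompactGL 3 L →
      ∃ A : ℂ → ℂ, DifferentiableOn ℂ A {z : ℂ | 1 < z.re} ∧ ∀ z : ℂ, 2 < z.re →
        (∫ v : ↥(adelicUnipotent (↥(maximalRealSubfield L)) L (IsCMField.complexConj L) 3), flatSectionU φ z ((quasiSplit (↥(maximalRealSubfield L)) L (IsCMField.complexConj L) 3).toAdelic (weylLongU ((IsCMField.complexConj L : L ≃ₐ[↥(maximalRealSubfield L)] L) : L →+* L) (rfl : (StdForm.antidiagonal 3).over L = (StdForm.antidiagonal 3).over L)) * ((v : (quasiSplit (↥(maximalRealSubfield L)) L (IsCMField.complexConj L) 3).Adelic) * k)) ∂ν) = cS z * A z) :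
    ∃ (n : ℕ) (φ' : Fin n → (quasiSplit (↥(maximalRealSubfield L)) L (IsCMField.complexConj L) 3).Adelic → ℂ) (q : Fin n → ℂ → ℂ) (Ec : ℂ → (quasiSplit (↥(maximalRealSubfield L)) L (IsCMField.complexConj L) 3).Adelic → ℂ) (qc : Fin n → ℂ → ℂ) (P : Set ℂ) (a : Fin n → ℂ → ℂ),
      -- the columns (★ (b′)) and the scattering coordinates (★ 7c)
      LinearIndependent ℂ φ' ∧ (∀ j, IsChiSectionPair (reflectChar (IsCMField.complexConj L) χ₁) χ₂ (φ' j)) ∧ (∀ j, Continuous (φ' j)) ∧ (∃ Mb : ℝ, ∀ j x, ‖φ' j x‖ ≤ Mb) ∧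
      (∀ j, DifferentiableOn ℂ (q j) {z : ℂ | 2 < z.re}) ∧
      (∀ z : ℂ, 2 < z.re → (∑ j, q j z • φ' j) = ((((ν 𝓕).toReal⁻¹ : ℝ)) : ℂ) • (fun g : (quasiSplit (↥(maximalRealSubfield L)) L (IsCMField.complexConj L) 3).Adelic => (∫ v : ↥(adelicUnipotent (↥(maximalRealSubfield L)) L (IsCMField.complexConj L) 3), flatSectionU φ z ((quasiSplit (↥(maximalRealSubfield L)) L (IsCMField.complexConj L) 3).toAdelic (weylLongU ((IsCMField.complexConj L : L ≃ₐ[↥(maximalRealSubfield L)] L) : L →+* L) (rfl : (StdForm.antidiagonal 3).over L = (StdForm.antidiagonal 3).over L)) * ((v : (quasiSplit (↥(maximalRealSubfield L)) L (IsCMField.complexConj L) 3).Adelic) * g)) ∂ν) * (((borelHeight g : ℝ) : ℂ) ^ (z - 2)))) ∧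
      -- ★ with-bound's clause list: (E1) normal forms, tube identity, `qc = q` on `{2 < Re}`, the pole set, analyticity ∕ holomorphy off `P`, (E4), (E2-bd)
      ((∀ g, MeromorphicNFOn (fun z => Ec z g) univ) ∧ (∀ j, MeromorphicNFOn (qc j) univ) ∧
      (∀ z : ℂ, 2 < z.re → Ec z = eisensteinSeriesU (flatSectionU φ z)) ∧ (∀ j (z : ℂ), 2 < z.re → qc j z = q j z) ∧
      IsClosed P ∧ (∀ z₀ : ℂ, ∀ᶠ s in 𝓝[≠] z₀, s ∉ P) ∧ (∀ z ∈ P, z.re ≤ 2) ∧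
      (∀ g (z : ℂ), z ∉ P → AnalyticAt ℂ (fun z => Ec z g) z) ∧ (∀ j (z : ℂ), z ∉ P → AnalyticAt ℂ (qc j) z) ∧
      (∀ g, DifferentiableOn ℂ (fun z => Ec z g) Pᶜ) ∧ (∀ j, DifferentiableOn ℂ (qc j) Pᶜ) ∧
      (∀ z : ℂ, z ∉ P → Continuous (Ec z)) ∧
      -- (E2-bd) THE JOINT LOCAL BOUND off `P`
      (∀ z₁ : ℂ, z₁ ∉ P → ∀ K : Set (quasiSplit (↥(maximalRealSubfield L)) L (IsCMField.complexConj L) 3).Adelic, IsCompact K → ∃ V ∈ 𝓝 z₁, ∃ M : ℝ, ∀ z ∈ V, ∀ g ∈ K, ‖Ec z g‖ ≤ M)) ∧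
      -- THE EULER FACTORISATION of the scattering coordinates (this file)
      ((∀ j, DifferentiableOn ℂ (a j) {z : ℂ | 1 < z.re}) ∧ (∀ j (z : ℂ), 2 < z.re → q j z = cS z * a j z)) := by
  obtain ⟨n, φ', q, Ec, qc, P, hli, hb, hc, hM, hqd, hqφ, hrest⟩ :=
    chiEisenstein_meromorphic_exports_kfinite_of_ports L μ νG ν h𝓕N h𝓕c h𝓕₀ hβ hμZ μa μf hχ₂ V hVK hVχ hVc hVM U₀ hU₀o hU₀c hU₀K hVU τ cB hVB hVτ hline hφ
  obtain ⟨a, ha, hqa⟩ := exists_eulerFactorisation_of_tubeClause L hli hb ν 𝓕 hqφ hunfK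
  exact ⟨n, φ', q, Ec, qc, P, a, hli, hb, hc, hM, hqd, hqφ, hrest, ha, hqa⟩

include μ h𝓕N h𝓕c h𝓕₀ hβ hμZ μa μf hχ₂ hVK hVχ hVc hVM hU₀o hU₀c hU₀K hVU hVB hVτ in
/-- **THE SAME FROM THE `z`-FREE CO-WEIGHT LINE** — ★ `chiEisenstein_meromorphic_exports_kfinite_of_ports_of_coweightLine` WITH the Euler factorisation (§1), per generator `φ ∈ V`,
modulo `hunfK`. [cite: Knapp1986, VII §1–§2] [cite: BernsteinLapid2019, Thm 2.3, §4 Claim 1] [cite: MoeglinWaldspurger1995, II.1.7, IV.1.8–IV.1.11] -/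
theorem exists_eulerFactorisation_kfinite_of_ports_of_coweightLine
    (χM : arch (↥(maximalRealSubfield L)) L (IsCMField.complexConj L) 3 ((StdForm.antidiagonal 3).over L) → ℂ)
    (hcBM : ∀ (z : ℂ), ∀ m ∈ (borelAdelic (↥(maximalRealSubfield L)) L (IsCMField.complexConj L) 3).comap (archToAdelic (↥(maximalRealSubfield L)) L (IsCMField.complexConj L) 3 ((StdForm.antidiagonal 3).over L)),
      m ∈ (((standardMaximalCompactGL 3 L).comap (adelicVal (↥(maximalRealSubfield L)) L (IsCMField.complexConj L) 3 ((StdForm.antidiagonal 3).over L))).comap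
        (archToAdelic (↥(maximalRealSubfield L)) L (IsCMField.complexConj L) 3 ((StdForm.antidiagonal 3).over L))) → cB z m = χM m)
    (hco : ∃ l₀ : W →ₗ[ℂ] ℂ, ∀ l : W →ₗ[ℂ] ℂ,
      (∀ m ∈ (borelAdelic (↥(maximalRealSubfield L)) L (IsCMField.complexConj L) 3).comap (archToAdelic (↥(maximalRealSubfield L)) L (IsCMField.complexConj L) 3 ((StdForm.antidiagonal 3).over L)),
        m ∈ (((standardMaximalCompactGL 3 L).comap (adelicVal (↥(maximalRealSubfield L)) L (IsCMField.complexConj L) 3 ((StdForm.antidiagonal 3).over L))).comap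
          (archToAdelic (↥(maximalRealSubfield L)) L (IsCMField.complexConj L) 3 ((StdForm.antidiagonal 3).over L))) → ∀ w, l (τ m w) = χM m * l w) → ∃ a : ℂ, l = a • l₀)
    {φ : (quasiSplit (↥(maximalRealSubfield L)) L (IsCMField.complexConj L) 3).Adelic → ℂ} (hφ : φ ∈ V) {cS : ℂ → ℂ}
    (hunfK : ∀ k : (quasiSplit (↥(maximalRealSubfield L)) L (IsCMField.complexConj L) 3).Adelic, adelicVal (↥(maximalRealSubfield L)) L (IsCMField.complexConj L) 3 ((StdForm.antidiagonal 3).over L) k ∈ standardMaximalCompactGL 3 L →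
      ∃ A : ℂ → ℂ, DifferentiableOn ℂ A {z : ℂ | 1 < z.re} ∧ ∀ z : ℂ, 2 < z.re →
        (∫ v : ↥(adelicUnipotent (↥(maximalRealSubfield L)) L (IsCMField.complexConj L) 3), flatSectionU φ z ((quasiSplit (↥(maximalRealSubfield L)) L (IsCMField.complexConj L) 3).toAdelic (weylLongU ((IsCMField.complexConj L : L ≃ₐ[↥(maximalRealSubfield L)] L) : L →+* L) (rfl : (StdForm.antidiagonal 3).over L = (StdForm.antidiagonal 3).over L)) * ((v : (quasiSplit (↥(maximalRealSubfield L)) L (IsCMField.complexConj L) 3).Adelic) * k)) ∂ν) = cS z * A z) :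
    ∃ (n : ℕ) (φ' : Fin n → (quasiSplit (↥(maximalRealSubfield L)) L (IsCMField.complexConj L) 3).Adelic → ℂ) (q : Fin n → ℂ → ℂ) (Ec : ℂ → (quasiSplit (↥(maximalRealSubfield L)) L (IsCMField.complexConj L) 3).Adelic → ℂ) (qc : Fin n → ℂ → ℂ) (P : Set ℂ) (a : Fin n → ℂ → ℂ),
      -- the columns (★ (b′)) and the scattering coordinates (★ 7c)
      LinearIndependent ℂ φ' ∧ (∀ j, IsChiSectionPair (reflectChar (IsCMField.complexConj L) χ₁) χ₂ (φ' j)) ∧ (∀ j, Continuous (φ' j)) ∧ (∃ Mb : ℝ, ∀ j x, ‖φ' j x‖ ≤ Mb) ∧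
      (∀ j, DifferentiableOn ℂ (q j) {z : ℂ | 2 < z.re}) ∧
      (∀ z : ℂ, 2 < z.re → (∑ j, q j z • φ' j) = ((((ν 𝓕).toReal⁻¹ : ℝ)) : ℂ) • (fun g : (quasiSplit (↥(maximalRealSubfield L)) L (IsCMField.complexConj L) 3).Adelic => (∫ v : ↥(adelicUnipotent (↥(maximalRealSubfield L)) L (IsCMField.complexConj L) 3), flatSectionU φ z ((quasiSplit (↥(maximalRealSubfield L)) L (IsCMField.complexConj L) 3).toAdelic (weylLongU ((IsCMField.complexConj L : L ≃ₐ[↥(maximalRealSubfield L)] L) : L →+* L) (rfl : (StdForm.antidiagonal 3).over L = (StdForm.antidiagonal 3).over L)) * ((v : (quasiSplit (↥(maximalRealSubfield L)) L (IsCMField.complexConj L) 3).Adelic) * g)) ∂ν) * (((borelHeight g : ℝ) : ℂ) ^ (z - 2)))) ∧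
      -- ★ with-bound's clause list: (E1) normal forms, tube identity, `qc = q` on `{2 < Re}`, the pole set, analyticity ∕ holomorphy off `P`, (E4), (E2-bd)
      ((∀ g, MeromorphicNFOn (fun z => Ec z g) univ) ∧ (∀ j, MeromorphicNFOn (qc j) univ) ∧
      (∀ z : ℂ, 2 < z.re → Ec z = eisensteinSeriesU (flatSectionU φ z)) ∧ (∀ j (z : ℂ), 2 < z.re → qc j z = q j z) ∧
      IsClosed P ∧ (∀ z₀ : ℂ, ∀ᶠ s in 𝓝[≠] z₀, s ∉ P) ∧ (∀ z ∈ P, z.re ≤ 2) ∧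
      (∀ g (z : ℂ), z ∉ P → AnalyticAt ℂ (fun z => Ec z g) z) ∧ (∀ j (z : ℂ), z ∉ P → AnalyticAt ℂ (qc j) z) ∧
      (∀ g, DifferentiableOn ℂ (fun z => Ec z g) Pᶜ) ∧ (∀ j, DifferentiableOn ℂ (qc j) Pᶜ) ∧
      (∀ z : ℂ, z ∉ P → Continuous (Ec z)) ∧
      -- (E2-bd) THE JOINT LOCAL BOUND off `P`
      (∀ z₁ : ℂ, z₁ ∉ P → ∀ K : Set (quasiSplit (↥(maximalRealSubfield L)) L (IsCMField.complexConj L) 3).Adelic, IsCompact K → ∃ V ∈ 𝓝 z₁, ∃ M : ℝ, ∀ z ∈ V, ∀ g ∈ K, ‖Ec z g‖ ≤ M)) ∧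
      -- THE EULER FACTORISATION of the scattering coordinates (this file)
      ((∀ j, DifferentiableOn ℂ (a j) {z : ℂ | 1 < z.re}) ∧ (∀ j (z : ℂ), 2 < z.re → q j z = cS z * a j z)) := by
  obtain ⟨n, φ', q, Ec, qc, P, hli, hb, hc, hM, hqd, hqφ, hrest⟩ :=
    chiEisenstein_meromorphic_exports_kfinite_of_ports_of_coweightLine L μ νG ν h𝓕N h𝓕c h𝓕₀ hβ hμZ μa μf hχ₂ V hVK hVχ hVc hVM U₀ hU₀o hU₀c hU₀K hVU τ cB hVB hVτ χM hcBM hco hφ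
  obtain ⟨a, ha, hqa⟩ := exists_eulerFactorisation_of_tubeClause L hli hb ν 𝓕 hqφ hunfK
  exact ⟨n, φ', q, Ec, qc, P, a, hli, hb, hc, hM, hqd, hqφ, hrest, ha, hqa⟩

end OfPorts

end Summit.HodgeConjecture.HodgeConjecture.Cruxes.H413.K2E1ChiScatteringCoordsEulerFactorisationKFiniteCMThree

end
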